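import Literature.Probability.FitznerVanDerHofstad2017.NobleNSumsRecord
import Literature.Probability.FitznerVanDerHofstad2017.NobleWeightedConvolution
import HarnessLib

/-!
# [FvdH17] Lemma 5.3, third display `(BoundXiIotaOne-3)`: the weight shift `‖x‖₂² ≤ 2(‖x − e_ι‖₂² + 1)` — PROVED

Source: R. Fitzner, R. van der Hofstad, *Mean-field behavior for nearest-neighbor percolation in `d > 10`*,
Electron. J. Probab. **22** (2017) no. 43 [FvdH17]; extended version arXiv:1506.07977v2, §5.2 Lemma 5.3
("Bounds on `Ξ^{(1),ι}_p`", p. 50), third display, TeX label `BoundXiIotaOne-3`: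

  `Σ_x ‖x‖₂² Ξ^{(1),ι}_p(x) ≤ 2 Σ_{ι,x} (‖x − e_ι‖₂² + 1) Ξ^{(1),ι}_p(x)`,

the elementary step by which the bound about the origin (`β_{ΔΞ^ι,0}^{(1)}`, Table 3 (p. 55) row
"`β_{ΔΞ^ι,0}^{(1)}` ↦ (BoundXiIotaOne-3)") is obtained from the bound about `e_ι` ((BoundXiIotaOne-2)) and the
unweighted bound ((BoundXiIotaOne-1)); in the accompanying notebook `Percolation.nb` this is cell 35,
`Bound[XiIota,1,Delta,0,s] = 2 Bound[XiIota,1,Delta,ei,s] + 2 Bound[XiIota,1,s]` (tree: `Stage1Cells.XiIota1D0 P =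
C 2 * XiIota1Dei P + C 2 * XiIota1 P`).

What is proved here (everything kernel-checked; no cited hypothesis):
* `euclidNorm_sq_le_two_mul_sq_sub_add`: `‖x‖₂² ≤ 2‖x − e‖₂² + 2‖e‖₂²` on `ℤ^d` (the tree's parallelogram bound
  `euclidNorm_sq_add_le` at `(x − e) + e`), and `euclidNorm_sq_le_two_mul_sq_sub_stepVec_add_one`:
  `‖x‖₂² ≤ 2(‖x − e_ι‖₂² + 1)`;
* `SumLE.sq_mul_of_sq_sub_stepVec_mul`: for ANY `f ≥ 0` on `ℤ^d`, `Σ_x ‖x − e_ι‖₂² f(x) ≤ β₁` and `Σ_x f(x) ≤ β₂`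
  (as genuine sums, `NobleAssumptions.SumLE`) give `Σ_x ‖x‖₂² f(x) ≤ 2β₁ + 2β₂` (with summability);
* `tsum_sq_mul_le_two_mul_tsum` (fixed `ι`, which is STRONGER than the printed display whose right side sums
  over all `ι`) and `tsum_sq_mul_le_two_mul_sum_tsum` (the printed shape, for any non-negative family indexed
  by the directions), specialised to `Ξ^{(N),ι}` in `tsum_sq_mul_nobleXiIotaN_le_printed` (any `N`; the lemma
  prints it for `N = 1`);
* the RECORD COROLLARY `NobleNSums.sumLE_sq_mul_of_XiIota1_cells`: `SumLE f (ev XiIota1) →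
  SumLE (‖· − e_ι‖₂² f) (ev XiIota1Dei) → SumLE (‖·‖₂² f) (ev XiIota1D0)` at the typed stage-1 cells
  (`NobleNSums.ev_XiIota1D0 : ev XiIota1D0 = 2 ev XiIota1Dei + 2 ev XiIota1`) — exactly the input `hc₁` of
  `NobleNSums.record_xiIotaDeltaZero_rows`.

Reading note. The printed left side carries a fixed `ι` and the right side the sum over `ι`; since every summand is
non-negative the fixed-`ι` inequality `Σ_x ‖x‖₂² Ξ^{(1),ι}(x) ≤ 2 Σ_x (‖x − e_ι‖₂² + 1) Ξ^{(1),ι}(x)` implies the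
printed one, and it is the fixed-`ι` form that cell 35 uses (the cells do not depend on `ι`, by the lattice
symmetry `NobleSymmetry.nobleXiIotaN_relabel`).  This is node N76-X1-i3 of the package DAG (LEMMAS §25); it is
`d`-generic and contains no numerical evaluation.
-/

noncomputable section

namespace Literature.Probability.FitznerVanDerHofstad2017

open Literature.Probability.LatticeModels Literature.Probability.Percolation
open Literature.Barriers.CriticalPhenomena
open scoped BigOperators

local notation "𝐞" => Literature.Probability.Percolation.stepVec

variable {d : ℕ}

/-! ## The pointwise shift -/

/-- `‖x‖₂² ≤ 2‖x − e‖₂² + 2‖e‖₂²` on `ℤ^d` (parallelogram bound at `(x − e) + e`). [folklore] -/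
theorem euclidNorm_sq_le_two_mul_sq_sub_add (x e : Site d) :
    euclidNorm x ^ 2 ≤ 2 * euclidNorm (x - e) ^ 2 + 2 * euclidNorm e ^ 2 := by
  have h := euclidNorm_sq_add_le (x - e) e
  rwa [sub_add_cancel] at h

/-- "`‖x − e_ι‖₂² ≤ 2‖t − e_ι‖₂² + 2‖t − x‖₂²`"-type step at the origin: `‖x‖₂² ≤ 2(‖x − e_ι‖₂² + 1)`
(`‖e_ι‖₂ = 1`). [cite: FitznerVanDerHofstad2017, Lemma 5.3 (BoundXiIotaOne-3) (arXiv:1506.07977v2 p. 50); proof p. 59 "we use ‖x−e_ι‖₂² ≤ 2‖t−e_ι‖₂²+2‖t−x‖₂²"] -/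
theorem euclidNorm_sq_le_two_mul_sq_sub_stepVec_add_one (x : Site d) (ι : Fin d × Bool) :
    euclidNorm x ^ 2 ≤ 2 * (euclidNorm (x - 𝐞 ι) ^ 2 + 1) := by
  have h := euclidNorm_sq_le_two_mul_sq_sub_add x (𝐞 ι)
  rw [euclidNorm_stepVec, one_pow] at h
  linarith

/-- The weighted pointwise form: `‖x‖₂² f(x) ≤ 2(‖x − e_ι‖₂² f(x)) + 2 f(x)` for `f(x) ≥ 0`. [folklore] -/
theorem sq_mul_le_of_nonneg {f : Site d → ℝ} (hf : ∀ x, 0 ≤ f x) (ι : Fin d × Bool) (x : Site d) :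
    euclidNorm x ^ 2 * f x ≤ 2 * (euclidNorm (x - 𝐞 ι) ^ 2 * f x) + 2 * f x := by
  have h := mul_le_mul_of_nonneg_right (euclidNorm_sq_le_two_mul_sq_sub_stepVec_add_one x ι) (hf x)
  linarith [h]

/-! ## Transport of `Σ`-bounds -/

/-- **(BoundXiIotaOne-3) as a transport of genuine-sum bounds**: for any `f ≥ 0` on `ℤ^d`,
`Σ_x ‖x − e_ι‖₂² f(x) ≤ β₁` and `Σ_x f(x) ≤ β₂` give `Σ_x ‖x‖₂² f(x) ≤ 2β₁ + 2β₂` (summability included).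
[cite: FitznerVanDerHofstad2017, Lemma 5.3 (BoundXiIotaOne-3) (arXiv:1506.07977v2 p. 50)] -/
theorem SumLE.sq_mul_of_sq_sub_stepVec_mul {f : Site d → ℝ} (hf : ∀ x, 0 ≤ f x) (ι : Fin d × Bool)
    {β₁ β₂ : ℝ} (h₁ : SumLE (fun x => euclidNorm (x - 𝐞 ι) ^ 2 * f x) β₁) (h₂ : SumLE f β₂) :
    SumLE (fun x => euclidNorm x ^ 2 * f x) (2 * β₁ + 2 * β₂) := by
  have hg : Summable (fun x => 2 * (euclidNorm (x - 𝐞 ι) ^ 2 * f x) + 2 * f x) :=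
    (h₁.1.mul_left 2).add (h₂.1.mul_left 2)
  have hle : ∀ x, euclidNorm x ^ 2 * f x ≤ 2 * (euclidNorm (x - 𝐞 ι) ^ 2 * f x) + 2 * f x :=
    sq_mul_le_of_nonneg hf ι
  have hnn : ∀ x, 0 ≤ euclidNorm x ^ 2 * f x := fun x => mul_nonneg (sq_nonneg _) (hf x)
  have hs : Summable (fun x => euclidNorm x ^ 2 * f x) := Summable.of_nonneg_of_le hnn hle hg
  refine ⟨hs, ?_⟩
  calc ∑' x, euclidNorm x ^ 2 * f x
      ≤ ∑' x, (2 * (euclidNorm (x - 𝐞 ι) ^ 2 * f x) + 2 * f x) := hs.tsum_le_tsum hle hg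
    _ = 2 * ∑' x, euclidNorm (x - 𝐞 ι) ^ 2 * f x + 2 * ∑' x, f x := by
        rw [(h₁.1.mul_left 2).tsum_add (h₂.1.mul_left 2), tsum_mul_left, tsum_mul_left]
    _ ≤ 2 * β₁ + 2 * β₂ := by linarith [h₁.2, h₂.2]

/-- **(BoundXiIotaOne-3) with a FIXED direction** (stronger than printed): for `f ≥ 0` with
`Σ_x (‖x − e_ι‖₂² + 1) f(x) < ∞`, `Σ_x ‖x‖₂² f(x) ≤ 2 Σ_x (‖x − e_ι‖₂² + 1) f(x)`.
[cite: FitznerVanDerHofstad2017, Lemma 5.3 (BoundXiIotaOne-3) (arXiv:1506.07977v2 p. 50)] -/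
theorem tsum_sq_mul_le_two_mul_tsum {f : Site d → ℝ} (hf : ∀ x, 0 ≤ f x) (ι : Fin d × Bool)
    (h : Summable (fun x => (euclidNorm (x - 𝐞 ι) ^ 2 + 1) * f x)) :
    ∑' x, euclidNorm x ^ 2 * f x ≤ 2 * ∑' x, (euclidNorm (x - 𝐞 ι) ^ 2 + 1) * f x := by
  have hle : ∀ x, euclidNorm x ^ 2 * f x ≤ 2 * ((euclidNorm (x - 𝐞 ι) ^ 2 + 1) * f x) := fun x => by
    have h' := sq_mul_le_of_nonneg hf ι x
    linarith [h']
  have hnn : ∀ x, 0 ≤ euclidNorm x ^ 2 * f x := fun x => mul_nonneg (sq_nonneg _) (hf x)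
  have hs : Summable (fun x => euclidNorm x ^ 2 * f x) := Summable.of_nonneg_of_le hnn hle (h.mul_left 2)
  calc ∑' x, euclidNorm x ^ 2 * f x
      ≤ ∑' x, 2 * ((euclidNorm (x - 𝐞 ι) ^ 2 + 1) * f x) := hs.tsum_le_tsum hle (h.mul_left 2)
    _ = 2 * ∑' x, (euclidNorm (x - 𝐞 ι) ^ 2 + 1) * f x := tsum_mul_left

/-- **(BoundXiIotaOne-3) in the printed shape**, for any non-negative family `Ξ^ι` indexed by the `2d`
directions with `Σ_x (‖x − e_ι‖₂² + 1) Ξ^ι(x) < ∞` for every `ι`: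
`Σ_x ‖x‖₂² Ξ^{ι₀}(x) ≤ 2 Σ_ι Σ_x (‖x − e_ι‖₂² + 1) Ξ^ι(x)`.
[cite: FitznerVanDerHofstad2017, Lemma 5.3 (BoundXiIotaOne-3) (arXiv:1506.07977v2 p. 50)] -/
theorem tsum_sq_mul_le_two_mul_sum_tsum {Ξ : Fin d × Bool → Site d → ℝ} (hΞ : ∀ ι x, 0 ≤ Ξ ι x)
    (ι₀ : Fin d × Bool) (h : ∀ ι, Summable (fun x => (euclidNorm (x - 𝐞 ι) ^ 2 + 1) * Ξ ι x)) :
    ∑' x, euclidNorm x ^ 2 * Ξ ι₀ x ≤ 2 * ∑ ι, ∑' x, (euclidNorm (x - 𝐞 ι) ^ 2 + 1) * Ξ ι x := by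
  refine (tsum_sq_mul_le_two_mul_tsum (hΞ ι₀) ι₀ (h ι₀)).trans ?_
  refine mul_le_mul_of_nonneg_left ?_ zero_le_two
  exact Finset.single_le_sum (f := fun ι => ∑' x, (euclidNorm (x - 𝐞 ι) ^ 2 + 1) * Ξ ι x)
    (fun ι _ => tsum_nonneg fun x => mul_nonneg (by positivity) (hΞ ι x)) (Finset.mem_univ ι₀)

/-- **[FvdH17] Lemma 5.3 (BoundXiIotaOne-3) for the NoBLE coefficients `Ξ^{(N),ι}_p`** (printed for `N = 1`;
the shift holds for every `N`): `Σ_x ‖x‖₂² Ξ^{(N),ι₀}(x) ≤ 2 Σ_ι Σ_x (‖x − e_ι‖₂² + 1) Ξ^{(N),ι}(x)` whenever the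
right-hand sums converge. [cite: FitznerVanDerHofstad2017, Lemma 5.3 (BoundXiIotaOne-3) (arXiv:1506.07977v2 p. 50)] -/
theorem tsum_sq_mul_nobleXiIotaN_le_printed (p : unitInterval) (N : ℕ) (ι₀ : Fin d × Bool)
    (h : ∀ ι, Summable (fun x => (euclidNorm (x - 𝐞 ι) ^ 2 + 1) * nobleXiIotaN d p (𝐞 ι) N x)) :
    ∑' x, euclidNorm x ^ 2 * nobleXiIotaN d p (𝐞 ι₀) N x
      ≤ 2 * ∑ ι, ∑' x, (euclidNorm (x - 𝐞 ι) ^ 2 + 1) * nobleXiIotaN d p (𝐞 ι) N x :=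
  tsum_sq_mul_le_two_mul_sum_tsum (fun ι x => nobleXiIotaN_nonneg p (𝐞 ι) N x) ι₀ h

/-- The `SumLE` transport for `Ξ^{(N),ι}_p` (the form consumed by Assumption 4.3's weighted `ι`-rows):
`SumLE (‖· − e_ι‖₂² Ξ^{(N),ι}) β₁ → SumLE Ξ^{(N),ι} β₂ → SumLE (‖·‖₂² Ξ^{(N),ι}) (2β₁ + 2β₂)`.
[cite: FitznerVanDerHofstad2017, Lemma 5.3 (BoundXiIotaOne-3) (arXiv:1506.07977v2 p. 50)] -/
theorem sumLE_sq_mul_nobleXiIotaN (p : unitInterval) (N : ℕ) (ι : Fin d × Bool) {β₁ β₂ : ℝ}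
    (h₁ : SumLE (fun x => euclidNorm (x - 𝐞 ι) ^ 2 * nobleXiIotaN d p (𝐞 ι) N x) β₁)
    (h₂ : SumLE (fun x => nobleXiIotaN d p (𝐞 ι) N x) β₂) :
    SumLE (fun x => euclidNorm x ^ 2 * nobleXiIotaN d p (𝐞 ι) N x) (2 * β₁ + 2 * β₂) :=
  SumLE.sq_mul_of_sq_sub_stepVec_mul (fun x => nobleXiIotaN_nonneg p (𝐞 ι) N x) ι h₁ h₂

/-! ## At the typed stage-1 cells: cell 35 -/

namespace NobleNSums

open Stage1Cells NoGoFrame BetaMap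

variable {ν : Type*} {D : Data ν} {y : State} {s : Pt}

/-- Cell 35 evaluated: `ev XiIota1D0 = 2 · ev XiIota1Dei + 2 · ev XiIota1`.
[cite: FitznerVanDerHofstad2017, notebook Percolation.nb cell 35 `Bound[XiIota,1,Delta,0,s] = 2 Bound[XiIota,1,Delta,ei,s] + 2 Bound[XiIota,1,s]`] -/
theorem ev_XiIota1D0 :
    D.ev s y (XiIota1D0 D.P) = 2 * D.ev s y (XiIota1Dei D.P) + 2 * D.ev s y (XiIota1 D.P) := by
  simp only [Data.ev, XiIota1D0, PX.eval_add, PX.eval_mul, PX.eval_C, Nat.cast_ofNat]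

/-- **The record corollary (node N76-X1-i3 at the cells)**: for any `f ≥ 0`, the cell bounds `Σ f ≤ ev XiIota1`
and `Σ ‖· − e_ι‖₂² f ≤ ev XiIota1Dei` give `Σ ‖·‖₂² f ≤ ev XiIota1D0` — the input `hc₁` of
`record_xiIotaDeltaZero_rows` (with `f = Ξ^{(1),ι}_p`).
[cite: FitznerVanDerHofstad2017, Lemma 5.3 (BoundXiIotaOne-3) (arXiv:1506.07977v2 p. 50); notebook Percolation.nb cell 35] -/
theorem sumLE_sq_mul_of_XiIota1_cells {f : Site d → ℝ} (hf : ∀ x, 0 ≤ f x) (ι : Fin d × Bool)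
    (h₁ : SumLE f (D.ev s y (XiIota1 D.P)))
    (h₂ : SumLE (fun x => euclidNorm (x - 𝐞 ι) ^ 2 * f x) (D.ev s y (XiIota1Dei D.P))) :
    SumLE (fun x => euclidNorm x ^ 2 * f x) (D.ev s y (XiIota1D0 D.P)) := by
  rw [ev_XiIota1D0]
  exact SumLE.sq_mul_of_sq_sub_stepVec_mul hf ι h₂ h₁

/-- The same for `f = Ξ^{(1),ι}_p` by name. [cite: FitznerVanDerHofstad2017, Lemma 5.3 (BoundXiIotaOne-3) (arXiv:1506.07977v2 p. 50); notebook Percolation.nb cell 35] -/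
theorem sumLE_sq_mul_nobleXiIotaN_one_cells (p : unitInterval) (ι : Fin d × Bool)
    (h₁ : SumLE (fun x => nobleXiIotaN d p (𝐞 ι) 1 x) (D.ev s y (XiIota1 D.P)))
    (h₂ : SumLE (fun x => euclidNorm (x - 𝐞 ι) ^ 2 * nobleXiIotaN d p (𝐞 ι) 1 x)
      (D.ev s y (XiIota1Dei D.P))) :
    SumLE (fun x => euclidNorm x ^ 2 * nobleXiIotaN d p (𝐞 ι) 1 x) (D.ev s y (XiIota1D0 D.P)) :=
  sumLE_sq_mul_of_XiIota1_cells (fun x => nobleXiIotaN_nonneg p (𝐞 ι) 1 x) ι h₁ h₂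

end NobleNSums

end Literature.Probability.FitznerVanDerHofstad2017

end
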